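import Summits.QuantumFields.YangMills.Theorems.PencilRigidityDiagonalMirrorRPRCentreTwistDefs
import Literature.MathematicalPhysics.QuantumFieldTheory.TiltedTorusSwapRP

/-!
# Stub `stub_twistedSwapRP` (S1') of the line `kms-variance-lukewarm-descent` (crux `stmt-QuantumFields-10604`)

Routes `PencilRigidity` / `MirrorModularBoosts` of `YangMills`, crux `DiagonalMirrorRPR`
(`Summit.QuantumFields.YangMills.Theses.MirrorModularBoosts.DiagonalMirrorRPR`, shared verbatim with the
`PencilRigidity` copy), line `kms-variance-lukewarm-descent` (lead tree absorbing `centre-twisted-swap`), stub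
`stub_twistedSwapRP` (S1').  Vocabulary: the box tori and the 45° cover (`TConfig`, `tstep`, `tplaq`, `taction`,
`tweight`, `thaar`, `tZ`, `texp`, `swapSite`, `swapEdge`, `swapConfig`, `posEdges`) from
`…Theorems.PencilRigidityDiagonalMirrorRPRStubRpClosureDefs`, the centre twist `centreTwist`, the twisted swap
`twistSwapConfig z = C_z ∘ θ^*` and the statement `CoverTwistedSwapRPAt` from
`…Theorems.PencilRigidityDiagonalMirrorRPRCentreTwistDefs` (same namespace, so the registered signature elaborates
unchanged).

**What is proved (`stub_twistedSwapRP`).** Twisted swap reflection positivity of Wilson's lattice gauge measure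
on the Fröhlich–Israel–Lieb–Simon 45° torus `T̃_N = ℤ_{2N} × ℤ_N × ℤ_N²` (sheared chart) at NON-POSITIVE
coupling: for a compact group `G`, a continuous unitary matrix representation `ρ`, a central `z` with `ρ z = −𝟙`,
`β ≤ 0`, `N ≥ 2` and every bounded measurable `F` depending only on the links of the closed half `0 ≤ u ≤ N`,
`⟨conj (F ∘ Θ'_z) · F⟩_β` is real and `≥ 0`, where `(Θ'_z U)(e) = z^{[e is an e₁-link]} · U(swapEdge e)`.

**Proof.** The twin of the Literature theorem `TiltedTorusRP.integral_conj_swap_mul_nonneg`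
(`Literature/MathematicalPhysics/QuantumFieldTheory/TiltedTorusSwapRP.lean`, FILS 1978 Thm. 2.1 on the tilted
torus), whose parametrized bookkeeping (shared block `M` = the `e₂,e₃`-links of the two mirror layers, positive
block `P`, the classes `cut`, `sh`, `pos` of plaquettes, the half-plaquette `cl`, the Gram coefficients `a`, the
observable `g`) is reused verbatim; only the three facts mentioning the reflection are re-proved for `Θ'_z`:
(i) `Θ'_z` preserves product Haar measure (relabelling by the involution `swapEdge`, then left translation by `z`
on the `e₁`-coordinates) and fixes the shared links, which are not `e₁`-links; (ii) on a cut plaquette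
`cl (Θ'_z U) = z · cl (θ^* U)` (`z` central), so with `ρ z = −𝟙` every Gram coefficient changes sign,
`a_i (Θ'_z U) = − a_i (θ^* U)`, and the cut identity of the untwisted file at coupling `|β| = −β ≥ 0` gives
`∑ᵢ aᵢ(U) conj aᵢ(Θ'_z U) = β · X(U)` with `aᵢ = √(−β/2) ·` (entries, conjugate entries of `ρ(cl U)`);
(iii) every plaquette holonomy is invariant under the centre twist (`tplaq_centreTwist`), so the positive and
shared parts of the action at `Θ'_z U` are those at `θ^* U`.  The tree engine
`LatticeRP.integral_mul_conj_mul_exp_nonneg_of_shared` then gives `0 ≤ ∫ conj F(Θ'_z U) F(U) e^{β·action} dHaar`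
as a complex number, and dividing by the real `Z ≥ 0` keeps `Re ≥ 0`, `Im = 0` (as in `stub_fortyFiveSwapRP`).
NOT claimed (false): plain swap-RP `CoverSwapRPAt ρ β N` at `β < 0`.

References: J. Fröhlich, R. Israel, E. H. Lieb, B. Simon, Comm. Math. Phys. 62 (1978) 1, Thm. 2.1; J. Stat. Phys.
22 (1980) 297, §3; G. 't Hooft, Nucl. Phys. B153 (1979) 141 (centre flux); K. Osterwalder, E. Seiler, Ann. Phys.
110 (1978) 440, §2.
-/

set_option autoImplicit false

noncomputable section

open scoped ComplexConjugate ComplexOrder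
open MeasureTheory
open Literature.MathematicalPhysics.QuantumLattice Literature.MathematicalPhysics.QuantumFieldTheory

namespace Summit.QuantumFields.YangMills.Cruxes.DiagonalMirrorRPR.CentreTwistedSwap

open ParityBridgeColdTraces TiltedTorusRP LatticeRP

namespace TwistedSwapRP

/-! ## The line's vocabulary as an instance of the parametrized data of `TiltedTorusRP` -/

section Data

variable {N : ℕ}

/-- The steps of the sheared chart are the steps `st` of `TiltedTorusRP`. -/
theorem tstep_true_eq :
    (tstep true : Fin 4 → TSite (2 * N) N N) =
      ![((1 : ZMod (2 * N)), (0 : ZMod N), (0 : ZMod N), (0 : ZMod N)),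
        ((-1 : ZMod (2 * N)), (1 : ZMod N), (0 : ZMod N), (0 : ZMod N)),
        ((0 : ZMod (2 * N)), (0 : ZMod N), (1 : ZMod N), (0 : ZMod N)),
        ((0 : ZMod (2 * N)), (0 : ZMod N), (0 : ZMod N), (1 : ZMod N))] := by
  funext i
  fin_cases i <;> simp [tstep]

/-- The site swap is the `θs` of `TiltedTorusRP`. -/
theorem swapSite_eq : (swapSite : TSite (2 * N) N N → TSite (2 * N) N N) =
    fun x => (-x.1, x.2.1 + ZMod.castHom (dvd_mul_left N 2) (ZMod N) x.1, x.2.2.1, x.2.2.2) := rfl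

/-- The link swap is the `θ` of `TiltedTorusRP`. -/
theorem swapEdge_eq : (swapEdge : TEdge (2 * N) N N → TEdge (2 * N) N N) =
    fun e => (swapSite e.1, Equiv.swap (0 : Fin 4) 1 e.2) := rfl

variable {G : Type} [Group G] {Nc : ℕ} (ρ : G →* Matrix (Fin Nc) (Fin Nc) ℂ)

/-- The plaquette holonomy is the `plaq` of `TiltedTorusRP`. -/
theorem tplaq_true_eq : (tplaq true : TConfig (2 * N) N N G → TSite (2 * N) N N → Fin 4 → Fin 4 → G) =
    fun U x i j => U (x, i) * U (x + tstep true i, j) * (U (x + tstep true j, i))⁻¹ * (U (x, j))⁻¹ := rfl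

variable [NeZero N]

/-- The closed positive half is the `Pos` of `TiltedTorusRP`. -/
theorem mem_posEdges_iff : ∀ e : TEdge (2 * N) N N,
    e ∈ posEdges N ↔ e.1.1.val ≤ N ∧ (e.1 + tstep true e.2).1.val ≤ N := fun _ => Iff.rfl

/-- Wilson's action is the `act` of `TiltedTorusRP`. -/
theorem taction_true_eq : (taction ρ true : TConfig (2 * N) N N G → ℝ) =
    fun U => ∑ x, ∑ i, ∑ j, if i < j then (ρ (tplaq true U x i j)).trace.re else 0 := rfl

end Data

/-! ## The three facts about the twisted reflection `Θ'_z` -/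

section Twist

variable {N : ℕ} [NeZero N] {G : Type} [Group G] {Nc : ℕ} (ρ : G →* Matrix (Fin Nc) (Fin Nc) ℂ) {z : G}
  {M P : Finset (TEdge (2 * N) N N)} {cut : Finset (TSite (2 * N) N N × Fin 4 × Fin 4)}
  {cl : TSite (2 * N) N N × Fin 4 × Fin 4 → TConfig (2 * N) N N G → G} {β : ℝ}
  {a : (TSite (2 * N) N N × Fin 4 × Fin 4) × Fin Nc × Fin Nc × Bool → TConfig (2 * N) N N G → ℂ}

/-- `Θ'_z` fixes the shared links (they are `e₂,e₃`-links of the mirror layers: no twist, fixed by the swap) —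
hypothesis `hΘM` of the engine. -/
theorem twistSwap_apply_of_mem_M (hM : ∀ e, e ∈ M ↔ (e.2 = 2 ∨ e.2 = 3) ∧ (e.1.1.val = 0 ∨ e.1.1.val = N))
    (z : G) (U : TConfig (2 * N) N N G) (e : TEdge (2 * N) N N) (he : e ∈ M) : twistSwapConfig z U e = U e := by
  obtain ⟨hi, -⟩ := (hM e).1 he
  have h2 : e.2 ≠ 1 := by rcases hi with h | h <;> rw [h] <;> decide
  show (if e.2 = 1 then z else 1) * U (swapEdge e) = U e
  rw [if_neg h2, one_mul, θ_of_mem_M swapSite_eq swapEdge_eq hM he]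

/-- The `P`-coordinates of `Θ'_z U` depend only on the coordinates of `U` off `P` — hypothesis `hΘdep` of the
engine (`C = ∅`), from the untwisted `dependsOn_comp_θ_apply`. -/
theorem dependsOn_twistSwap_apply
    (hM : ∀ e, e ∈ M ↔ (e.2 = 2 ∨ e.2 = 3) ∧ (e.1.1.val = 0 ∨ e.1.1.val = N))
    (hP : ∀ e, e ∈ P ↔ e ∈ posEdges N ∧ e ∉ M) (hN : 2 ≤ N) (z : G) (e : TEdge (2 * N) N N)
    (he : e ∈ (P ∪ ∅ : Finset _)) :
    DependsOn (fun U : TConfig (2 * N) N N G => twistSwapConfig z U e)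
      ((Pᶜ : Finset _) : Set (TEdge (2 * N) N N)) := by
  intro U V hUV
  have h := dependsOn_comp_θ_apply tstep_true_eq swapSite_eq swapEdge_eq mem_posEdges_iff hM hP hN (G := G) e he
    hUV
  show (if e.2 = 1 then z else 1) * U (swapEdge e) = (if e.2 = 1 then z else 1) * V (swapEdge e)
  rw [show U (swapEdge e) = V (swapEdge e) from h]

omit [NeZero N] in
/-- On every plaquette label, the half-plaquette of the twisted swap is `z` times that of the plain swap
(`cl` is a product of one `e₀`-link and one `e₁`-link; `z` central). -/
theorem cl_twistSwap (hz : z ∈ Subgroup.center G)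
    (hcl : cl = fun k U => if k.1.1 = 0 then U (k.1, 0) * U (k.1 + tstep true 0, 1)
      else U (k.1, 1) * U (k.1 + tstep true 1, 0))
    (k : TSite (2 * N) N N × Fin 4 × Fin 4) (U : TConfig (2 * N) N N G) :
    cl k (twistSwapConfig z U) = z * cl k (U ∘ swapEdge) := by
  have hc : ∀ g : G, g * z = z * g := fun g => Subgroup.mem_center_iff.1 hz g
  have h0 : ∀ y : TSite (2 * N) N N, twistSwapConfig z U (y, 0) = U (swapEdge (y, 0)) := fun y => by
    show (if (0 : Fin 4) = 1 then z else 1) * _ = _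
    rw [if_neg (by decide), one_mul]
  have h1 : ∀ y : TSite (2 * N) N N, twistSwapConfig z U (y, 1) = z * U (swapEdge (y, 1)) := fun y => by
    show (if (1 : Fin 4) = 1 then z else 1) * _ = _
    rw [if_pos rfl]
  subst hcl
  dsimp only
  split_ifs with hk
  · rw [h0, h1, Function.comp_apply, Function.comp_apply, ← mul_assoc, hc, mul_assoc]
  · rw [h0, h1, Function.comp_apply, Function.comp_apply, mul_assoc]

omit [NeZero N] in
/-- **The sign flip**: with `ρ z = −𝟙`, every Gram coefficient of the twisted swap is minus that of the plain
swap, `aᵢ (Θ'_z U) = − aᵢ (θ^* U)`. -/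
theorem a_twistSwap (hz : z ∈ Subgroup.center G) (hρz : ρ z = -1)
    (hcl : cl = fun k U => if k.1.1 = 0 then U (k.1, 0) * U (k.1 + tstep true 0, 1)
      else U (k.1, 1) * U (k.1 + tstep true 1, 0))
    (ha : a = fun i U => if i.1 ∈ cut then (Real.sqrt (-β / 2) : ℂ) *
      (if i.2.2.2 then conj (ρ (cl i.1 U) i.2.1 i.2.2.1) else ρ (cl i.1 U) i.2.1 i.2.2.1) else 0)
    (i : (TSite (2 * N) N N × Fin 4 × Fin 4) × Fin Nc × Fin Nc × Bool) (U : TConfig (2 * N) N N G) :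
    a i (twistSwapConfig z U) = -a i (U ∘ swapEdge) := by
  have hρcl : ρ (cl i.1 (twistSwapConfig z U)) = -ρ (cl i.1 (U ∘ swapEdge)) := by
    rw [cl_twistSwap hz hcl, map_mul, hρz, neg_one_mul]
  subst ha
  dsimp only
  split_ifs with hk hb
  · rw [hρcl, Matrix.neg_apply, map_neg, mul_neg]
  · rw [hρcl, Matrix.neg_apply, mul_neg]
  · rw [neg_zero]

/-- **The cut Boltzmann weight at `β ≤ 0` is a Gram kernel for the twisted swap**: with
`aᵢ ∈ {√(−β/2) ρ(P₊)_{ab}, √(−β/2) conj ρ(P₊)_{ab}}` on cut plaquettes, `∑ᵢ aᵢ(U) conj aᵢ(Θ'_z U) = β X(U)`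
(the untwisted identity at coupling `−β ≥ 0` and the sign flip). -/
theorem sum_a_mul_conj_twist (hz : z ∈ Subgroup.center G) (hρz : ρ z = -1)
    (hcut : ∀ k, k ∈ cut ↔ k.2.1 = 0 ∧ k.2.2 = 1 ∧ (k.1.1.val = 0 ∨ k.1.1.val = N))
    (hcl : cl = fun k U => if k.1.1 = 0 then U (k.1, 0) * U (k.1 + tstep true 0, 1)
      else U (k.1, 1) * U (k.1 + tstep true 1, 0))
    (ha : a = fun i U => if i.1 ∈ cut then (Real.sqrt (-β / 2) : ℂ) *
      (if i.2.2.2 then conj (ρ (cl i.1 U) i.2.1 i.2.2.1) else ρ (cl i.1 U) i.2.1 i.2.2.1) else 0)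
    (hu : ∀ g, ρ g ∈ Matrix.unitaryGroup (Fin Nc) ℂ) (hβ : β ≤ 0) (U : TConfig (2 * N) N N G) :
    ∑ i, a i U * conj (a i (twistSwapConfig z U)) =
      ((β * ∑ k ∈ cut, (ρ (tplaq true U k.1 k.2.1 k.2.2)).trace.re : ℝ) : ℂ) := by
  have h := sum_a_mul_conj tstep_true_eq swapSite_eq swapEdge_eq hcut ρ tplaq_true_eq hcl ha hu
    (by linarith) U
  simp_rw [a_twistSwap ρ hz hρz hcl ha, map_neg, mul_neg, Finset.sum_neg_distrib, h]
  push_cast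
  ring

end Twist

/-! ## The pointwise identity and the un-normalised positivity -/

section Assembly

variable {N : ℕ} [NeZero N] {G : Type} [Group G] {Nc : ℕ} (ρ : G →* Matrix (Fin Nc) (Fin Nc) ℂ) {z : G}
  {M P : Finset (TEdge (2 * N) N N)} {lt cut sh pos neg : Finset (TSite (2 * N) N N × Fin 4 × Fin 4)}
  {cl : TSite (2 * N) N N × Fin 4 × Fin 4 → TConfig (2 * N) N N G → G} {β : ℝ}
  {a : (TSite (2 * N) N N × Fin 4 × Fin 4) × Fin Nc × Fin Nc × Bool → TConfig (2 * N) N N G → ℂ}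
  {F g : TConfig (2 * N) N N G → ℂ}

/-- **The pointwise identity** for the twisted swap:
`conj F(Θ'_z U) F(U) e^{β ∑ Re tr ρ(U_p)} = g(U) conj g(Θ'_z U) exp(∑ᵢ aᵢ(U) conj aᵢ(Θ'_z U))` — the split of the
action of the untwisted file, the twisted Gram identity on the cut, and centre invariance of every plaquette
holonomy (`tplaq_centreTwist`) for the positive and shared parts at `Θ'_z U = C_z (θ^* U)`. -/
theorem integrand_eq_twist (hz : z ∈ Subgroup.center G) (hρz : ρ z = -1)
    (hM : ∀ e, e ∈ M ↔ (e.2 = 2 ∨ e.2 = 3) ∧ (e.1.1.val = 0 ∨ e.1.1.val = N))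
    (hlt : ∀ k, k ∈ lt ↔ k.2.1 < k.2.2)
    (hcut : ∀ k, k ∈ cut ↔ k.2.1 = 0 ∧ k.2.2 = 1 ∧ (k.1.1.val = 0 ∨ k.1.1.val = N))
    (hsh : ∀ k, k ∈ sh ↔ k.2.1 = 2 ∧ k.2.2 = 3 ∧ (k.1.1.val = 0 ∨ k.1.1.val = N))
    (hpos : ∀ k, k ∈ pos ↔
      (k.2.1 = 0 ∧ k.2.2 = 1 ∧ 1 ≤ k.1.1.val ∧ k.1.1.val + 1 ≤ N) ∨
      (k.2.1 = 0 ∧ (k.2.2 = 2 ∨ k.2.2 = 3) ∧ k.1.1.val + 1 ≤ N) ∨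
      (k.2.1 = 1 ∧ (k.2.2 = 2 ∨ k.2.2 = 3) ∧ 1 ≤ k.1.1.val ∧ k.1.1.val ≤ N) ∨
      (k.2.1 = 2 ∧ k.2.2 = 3 ∧ 1 ≤ k.1.1.val ∧ k.1.1.val + 1 ≤ N))
    (hneg : neg = lt \ (cut ∪ sh ∪ pos))
    (hcl : cl = fun k U => if k.1.1 = 0 then U (k.1, 0) * U (k.1 + tstep true 0, 1)
      else U (k.1, 1) * U (k.1 + tstep true 1, 0))
    (ha : a = fun i U => if i.1 ∈ cut then (Real.sqrt (-β / 2) : ℂ) *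
      (if i.2.2.2 then conj (ρ (cl i.1 U) i.2.1 i.2.2.1) else ρ (cl i.1 U) i.2.1 i.2.2.1) else 0)
    (hg : g = fun U => F U * (Real.exp (β * ∑ k ∈ pos, (ρ (tplaq true U k.1 k.2.1 k.2.2)).trace.re +
      β / 2 * ∑ k ∈ sh, (ρ (tplaq true U k.1 k.2.1 k.2.2)).trace.re) : ℂ))
    (hN : 2 ≤ N) (hu : ∀ g, ρ g ∈ Matrix.unitaryGroup (Fin Nc) ℂ) (hβ : β ≤ 0) (U : TConfig (2 * N) N N G) :
    conj (F (twistSwapConfig z U)) * F U * ((Real.exp (β * taction ρ true U) : ℝ) : ℂ) =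
      g U * conj (g (twistSwapConfig z U)) * Complex.exp (∑ i, a i U * conj (a i (twistSwapConfig z U))) := by
  have hplq : ∀ s : Finset (TSite (2 * N) N N × Fin 4 × Fin 4),
      ∑ k ∈ s, (ρ (tplaq true (twistSwapConfig z U) k.1 k.2.1 k.2.2)).trace.re =
        ∑ k ∈ s, (ρ (tplaq true (U ∘ swapEdge) k.1 k.2.1 k.2.2)).trace.re := fun s =>
    Finset.sum_congr rfl fun k _ => by rw [twistSwapConfig_eq, tplaq_centreTwist hz]; rfl
  rw [sum_a_mul_conj_twist ρ hz hρz hcut hcl ha hu hβ U, ← Complex.ofReal_exp,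
    act_split tstep_true_eq swapSite_eq swapEdge_eq rfl rfl hlt hcut hsh hpos hneg ρ tplaq_true_eq
      (taction_true_eq ρ) hN hu U]
  subst hg
  dsimp only
  rw [hplq pos, hplq sh, sum_sh_comp_θ tstep_true_eq swapSite_eq swapEdge_eq hM hsh ρ tplaq_true_eq U]
  simp only [map_mul, Complex.conj_ofReal]
  set XC := ∑ k ∈ cut, (ρ (tplaq true U k.1 k.2.1 k.2.2)).trace.re
  set XM := ∑ k ∈ sh, (ρ (tplaq true U k.1 k.2.1 k.2.2)).trace.re
  set XP := ∑ k ∈ pos, (ρ (tplaq true U k.1 k.2.1 k.2.2)).trace.re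
  set XP' := ∑ k ∈ pos, (ρ (tplaq true (U ∘ swapEdge) k.1 k.2.1 k.2.2)).trace.re
  rw [show β * (XC + XM + XP + XP') = (β * XP + β / 2 * XM) + (β * XP' + β / 2 * XM) + β * XC by ring,
    Real.exp_add, Real.exp_add]
  push_cast
  ring

variable [TopologicalSpace G] [IsTopologicalGroup G] [CompactSpace G] [MeasurableSpace G] [BorelSpace G]

/-- **The centre twist preserves product Haar measure** (coordinatewise left translation by `z` or `1`; Haar
measure is left invariant). -/
theorem measurePreserving_centreTwist (z : G) :
    MeasurePreserving (centreTwist (N := N) z)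
      (thaar (2 * N) N N : Measure (TConfig (2 * N) N N G)) (thaar (2 * N) N N) := by
  haveI : (haarProbability G).IsMulLeftInvariant := by
    rw [haarProbability]
    infer_instance
  exact measurePreserving_pi (fun _ : TEdge (2 * N) N N => haarProbability G) (fun _ => haarProbability G)
    (f := fun e g => (if e.2 = 1 then z else 1) * g) fun e => measurePreserving_mul_left (haarProbability G) _

/-- **The twisted swap `Θ'_z = C_z ∘ θ^*` preserves product Haar measure** (hypothesis `hΘ` of the engine; it
need not be an involution). -/
theorem measurePreserving_twistSwap (z : G) :
    MeasurePreserving (twistSwapConfig (N := N) z)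
      (thaar (2 * N) N N : Measure (TConfig (2 * N) N N G)) (thaar (2 * N) N N) :=
  (measurePreserving_centreTwist z).comp (measurePreserving_comp_θ swapSite_eq swapEdge_eq)

/-- **Twisted swap reflection positivity of the un-normalised Wilson weight at `β ≤ 0`** (bookkeeping finsets as
parameters): `0 ≤ ∫ conj F(Θ'_z U) F(U) exp(β ∑ Re tr ρ(U_p)) ∏ dU_e` as a complex number — the tree engine
`LatticeRP.integral_mul_conj_mul_exp_nonneg_of_shared` with `Θ := Θ'_z`, shared block `M`, positive block `P`,
no crossing links. -/
theorem integral_conj_twistSwap_mul_nonneg_aux (hz : z ∈ Subgroup.center G) (hρz : ρ z = -1)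
    (hM : ∀ e, e ∈ M ↔ (e.2 = 2 ∨ e.2 = 3) ∧ (e.1.1.val = 0 ∨ e.1.1.val = N))
    (hP : ∀ e, e ∈ P ↔ e ∈ posEdges N ∧ e ∉ M)
    (hlt : ∀ k, k ∈ lt ↔ k.2.1 < k.2.2)
    (hcut : ∀ k, k ∈ cut ↔ k.2.1 = 0 ∧ k.2.2 = 1 ∧ (k.1.1.val = 0 ∨ k.1.1.val = N))
    (hsh : ∀ k, k ∈ sh ↔ k.2.1 = 2 ∧ k.2.2 = 3 ∧ (k.1.1.val = 0 ∨ k.1.1.val = N))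
    (hpos : ∀ k, k ∈ pos ↔
      (k.2.1 = 0 ∧ k.2.2 = 1 ∧ 1 ≤ k.1.1.val ∧ k.1.1.val + 1 ≤ N) ∨
      (k.2.1 = 0 ∧ (k.2.2 = 2 ∨ k.2.2 = 3) ∧ k.1.1.val + 1 ≤ N) ∨
      (k.2.1 = 1 ∧ (k.2.2 = 2 ∨ k.2.2 = 3) ∧ 1 ≤ k.1.1.val ∧ k.1.1.val ≤ N) ∨
      (k.2.1 = 2 ∧ k.2.2 = 3 ∧ 1 ≤ k.1.1.val ∧ k.1.1.val + 1 ≤ N))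
    (hneg : neg = lt \ (cut ∪ sh ∪ pos))
    (hcl : cl = fun k U => if k.1.1 = 0 then U (k.1, 0) * U (k.1 + tstep true 0, 1)
      else U (k.1, 1) * U (k.1 + tstep true 1, 0))
    (ha : a = fun i U => if i.1 ∈ cut then (Real.sqrt (-β / 2) : ℂ) *
      (if i.2.2.2 then conj (ρ (cl i.1 U) i.2.1 i.2.2.1) else ρ (cl i.1 U) i.2.1 i.2.2.1) else 0)
    (hg : g = fun U => F U * (Real.exp (β * ∑ k ∈ pos, (ρ (tplaq true U k.1 k.2.1 k.2.2)).trace.re +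
      β / 2 * ∑ k ∈ sh, (ρ (tplaq true U k.1 k.2.1 k.2.2)).trace.re) : ℂ))
    (hN : 2 ≤ N) (hρ : Continuous ρ) (hu : ∀ g, ρ g ∈ Matrix.unitaryGroup (Fin Nc) ℂ) (hβ : β ≤ 0)
    (hF : Measurable F) {C : ℝ} (hFb : ∀ U, ‖F U‖ ≤ C) (hFdep : DependsOn F (posEdges N)) :
    0 ≤ ∫ U, conj (F (twistSwapConfig z U)) * F U * ((Real.exp (β * taction ρ true U) : ℝ) : ℂ)
      ∂(thaar (2 * N) N N : Measure (TConfig (2 * N) N N G)) := by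
  have key := integral_mul_conj_mul_exp_nonneg_of_shared (haarProbability G) M P
    (∅ : Finset (TEdge (2 * N) N N)) (twistSwapConfig z) (measurePreserving_twistSwap z)
    (fun U e he => twistSwap_apply_of_mem_M hM z U e he)
    (fun e he => dependsOn_twistSwap_apply hM hP hN z e he) (disjoint_M_P hP)
    (Finset.disjoint_empty_right _) (measurable_g ρ tplaq_true_eq hg hρ hF)
    (fun i => measurable_a (st := tstep true) ρ hcl ha hρ i) (norm_g_le (plaq := tplaq true) ρ hg hu hFb) (fun i U => norm_a_le ρ ha hu i U)
    (dependsOn_union_of_Pos hP (dependsOn_g tstep_true_eq mem_posEdges_iff hM hsh hpos ρ tplaq_true_eq hg hFdep))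
    (fun i => dependsOn_union_of_Pos hP (dependsOn_a tstep_true_eq mem_posEdges_iff hcut ρ hcl ha i))
  have hsplice : ∀ p : TConfig (2 * N) N N G × TConfig (2 * N) N N G,
      splice (∅ : Finset (TEdge (2 * N) N N)) p = p.1 := fun p => by
    funext i
    simp [splice_apply]
  simp_rw [hsplice] at key
  rw [integral_fun_fst (fun U : TConfig (2 * N) N N G =>
      g U * conj (g (twistSwapConfig z U)) * Complex.exp (∑ i, a i U * conj (a i (twistSwapConfig z U)))),
    probReal_univ, one_smul] at key
  simp_rw [← integrand_eq_twist ρ hz hρz hM hlt hcut hsh hpos hneg hcl ha hg hN hu hβ] at key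
  exact key

/-- **Twisted swap reflection positivity of the un-normalised Wilson weight on `T̃_N` at `β ≤ 0`**: for a
compact group `G`, a continuous unitary `ρ`, a central `z` with `ρ z = −𝟙`, `β ≤ 0`, `N ≥ 2` and `F` bounded
measurable depending only on the closed positive half,
`0 ≤ ∫ conj F(Θ'_z U) · F U · e^{β · action(U)} dHaar(U)` as a complex number. -/
theorem integral_conj_twistSwap_mul_nonneg (hz : z ∈ Subgroup.center G) (hρz : ρ z = -1) (hN : 2 ≤ N)
    (hρ : Continuous ρ) (hu : ∀ g, ρ g ∈ Matrix.unitaryGroup (Fin Nc) ℂ) (hβ : β ≤ 0)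
    (hF : Measurable F) {C : ℝ} (hFb : ∀ U, ‖F U‖ ≤ C) (hFdep : DependsOn F (posEdges N)) :
    0 ≤ ∫ U, conj (F (twistSwapConfig z U)) * F U * ((tweight ρ β true U : ℝ) : ℂ)
      ∂(thaar (2 * N) N N : Measure (TConfig (2 * N) N N G)) := by
  classical
  -- the bookkeeping objects, verbatim from `TiltedTorusRP.integral_conj_swap_mul_nonneg` (coefficients at `−β`)
  set M : Finset (TEdge (2 * N) N N) :=
    Finset.univ.filter fun e => (e.2 = 2 ∨ e.2 = 3) ∧ (e.1.1.val = 0 ∨ e.1.1.val = N) with hMdef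
  have hM : ∀ e, e ∈ M ↔ (e.2 = 2 ∨ e.2 = 3) ∧ (e.1.1.val = 0 ∨ e.1.1.val = N) := fun e => by
    rw [hMdef, Finset.mem_filter]; simp
  set P : Finset (TEdge (2 * N) N N) := Finset.univ.filter fun e => e ∈ posEdges N ∧ e ∉ M with hPdef
  have hP : ∀ e, e ∈ P ↔ e ∈ posEdges N ∧ e ∉ M := fun e => by rw [hPdef, Finset.mem_filter]; simp
  set lt : Finset (TSite (2 * N) N N × Fin 4 × Fin 4) := Finset.univ.filter fun k => k.2.1 < k.2.2 with hltdef
  have hlt : ∀ k, k ∈ lt ↔ k.2.1 < k.2.2 := fun k => by rw [hltdef, Finset.mem_filter]; simp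
  set cut : Finset (TSite (2 * N) N N × Fin 4 × Fin 4) :=
    Finset.univ.filter fun k => k.2.1 = 0 ∧ k.2.2 = 1 ∧ (k.1.1.val = 0 ∨ k.1.1.val = N) with hcutdef
  have hcut : ∀ k, k ∈ cut ↔ k.2.1 = 0 ∧ k.2.2 = 1 ∧ (k.1.1.val = 0 ∨ k.1.1.val = N) := fun k => by
    rw [hcutdef, Finset.mem_filter]; simp
  set sh : Finset (TSite (2 * N) N N × Fin 4 × Fin 4) :=
    Finset.univ.filter fun k => k.2.1 = 2 ∧ k.2.2 = 3 ∧ (k.1.1.val = 0 ∨ k.1.1.val = N) with hshdef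
  have hsh : ∀ k, k ∈ sh ↔ k.2.1 = 2 ∧ k.2.2 = 3 ∧ (k.1.1.val = 0 ∨ k.1.1.val = N) := fun k => by
    rw [hshdef, Finset.mem_filter]; simp
  set pos : Finset (TSite (2 * N) N N × Fin 4 × Fin 4) :=
    Finset.univ.filter fun k =>
      (k.2.1 = 0 ∧ k.2.2 = 1 ∧ 1 ≤ k.1.1.val ∧ k.1.1.val + 1 ≤ N) ∨
      (k.2.1 = 0 ∧ (k.2.2 = 2 ∨ k.2.2 = 3) ∧ k.1.1.val + 1 ≤ N) ∨
      (k.2.1 = 1 ∧ (k.2.2 = 2 ∨ k.2.2 = 3) ∧ 1 ≤ k.1.1.val ∧ k.1.1.val ≤ N) ∨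
      (k.2.1 = 2 ∧ k.2.2 = 3 ∧ 1 ≤ k.1.1.val ∧ k.1.1.val + 1 ≤ N) with hposdef
  have hpos : ∀ k, k ∈ pos ↔
      (k.2.1 = 0 ∧ k.2.2 = 1 ∧ 1 ≤ k.1.1.val ∧ k.1.1.val + 1 ≤ N) ∨
      (k.2.1 = 0 ∧ (k.2.2 = 2 ∨ k.2.2 = 3) ∧ k.1.1.val + 1 ≤ N) ∨
      (k.2.1 = 1 ∧ (k.2.2 = 2 ∨ k.2.2 = 3) ∧ 1 ≤ k.1.1.val ∧ k.1.1.val ≤ N) ∨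
      (k.2.1 = 2 ∧ k.2.2 = 3 ∧ 1 ≤ k.1.1.val ∧ k.1.1.val + 1 ≤ N) := fun k => by
    rw [hposdef, Finset.mem_filter]; simp
  set cl : TSite (2 * N) N N × Fin 4 × Fin 4 → TConfig (2 * N) N N G → G :=
    fun k U => if k.1.1 = 0 then U (k.1, 0) * U (k.1 + tstep true 0, 1)
      else U (k.1, 1) * U (k.1 + tstep true 1, 0) with hcl
  set a : (TSite (2 * N) N N × Fin 4 × Fin 4) × Fin Nc × Fin Nc × Bool → TConfig (2 * N) N N G → ℂ :=
    fun i U => if i.1 ∈ cut then (Real.sqrt (-β / 2) : ℂ) *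
      (if i.2.2.2 then conj (ρ (cl i.1 U) i.2.1 i.2.2.1) else ρ (cl i.1 U) i.2.1 i.2.2.1) else 0 with ha
  set g : TConfig (2 * N) N N G → ℂ :=
    fun U => F U * (Real.exp (β * ∑ k ∈ pos, (ρ (tplaq true U k.1 k.2.1 k.2.2)).trace.re +
      β / 2 * ∑ k ∈ sh, (ρ (tplaq true U k.1 k.2.1 k.2.2)).trace.re) : ℂ) with hg
  exact integral_conj_twistSwap_mul_nonneg_aux ρ hz hρz hM hP hlt hcut hsh hpos (neg := lt \ (cut ∪ sh ∪ pos))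
    rfl hcl ha hg hN hρ hu hβ hF hFb hFdep

end Assembly

end TwistedSwapRP

/-! ## The registered stub -/

/-- **S1' (M), `stub_twistedSwapRP` — twisted swap-RP of Wilson's measure on the 45° torus at non-positive
coupling.**  For every compact `G`, continuous unitary `ρ`, central `z` with `ρ z = −𝟙`, `β ≤ 0`, `N ≥ 2` and
every bounded measurable `F` of the closed positive half `0 ≤ u ≤ N`: `⟨conj(F ∘ Θ'_z) · F⟩_β` is real and `≥ 0`,
where `Θ'_z U = C_z (θ^*U)` (`twistSwapConfig`).  Proof: the un-normalised integral is a real non-negative complex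
number by `TwistedSwapRP.integral_conj_twistSwap_mul_nonneg` (the twin of FILS 1978 Thm. 2.1 on the tilted torus
with the centre-twisted reflection, reduced to the tree engine `LatticeRP.integral_mul_conj_mul_exp_nonneg_of_shared`);
dividing by the real number `Z ≥ 0` keeps `Re ≥ 0` and `Im = 0`.  NOT claimed (false): plain `CoverSwapRPAt ρ β N`
at `β < 0`. -/
theorem stub_twistedSwapRP :
    ∀ (G : Type) [Group G] [TopologicalSpace G] [IsTopologicalGroup G] [CompactSpace G]
      [MeasurableSpace G] [BorelSpace G] (Nc : ℕ) (ρ : G →* Matrix (Fin Nc) (Fin Nc) ℂ),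
      Continuous ρ → (∀ g, ρ g ∈ Matrix.unitaryGroup (Fin Nc) ℂ) →
        ∀ z ∈ Subgroup.center G, ρ z = -1 →
          ∀ (β : ℝ), β ≤ 0 → ∀ (N : ℕ) [NeZero N], 2 ≤ N → CoverTwistedSwapRPAt ρ z β N := by
  intro G _ _ _ _ _ _ Nc ρ hρ hu z hz hρz β hβ N _ hN F hF hFb hFdep
  obtain ⟨C, hC⟩ := hFb
  have hI : 0 ≤ ∫ U, conj (F (twistSwapConfig z U)) * F U * ((tweight ρ β true U : ℝ) : ℂ)
      ∂(thaar (2 * N) N N : Measure (TConfig (2 * N) N N G)) :=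
    TwistedSwapRP.integral_conj_twistSwap_mul_nonneg ρ hz hρz hN hρ hu hβ hF hC hFdep
  have hZ : 0 ≤ tZ ρ (2 * N) N N β true (G := G) := integral_nonneg fun U => (Real.exp_pos _).le
  obtain ⟨hre, him⟩ := Complex.nonneg_iff.1 hI
  unfold texp
  rw [Complex.div_ofReal_re, Complex.div_ofReal_im]
  exact ⟨div_nonneg hre hZ, by rw [← him, zero_div]⟩

end Summit.QuantumFields.YangMills.Cruxes.DiagonalMirrorRPR.CentreTwistedSwap

end
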